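import Literature.NumberTheory.Automorphic.Liu2021.Thm418CombinedOfRationalPullback
import HarnessLib

/-!
# [Liu 2021, proof of Thm. 4.18] — «It canonically extends to a map (4.3)»: the map (4.3) EXISTS, is UNIQUE, and drops out of
# the r8-at-one-`μ` statement (no `J` binder at all)

Y. Liu, *Fourier–Jacobi cycles and arithmetic relative trace formula*, Camb. J. Math. **9** (2021) 1–147 = arXiv:2102.11518
[Liu2021]; TeX source `FJcycle.tex` (md5 `6db49a74122d2cb0f224fa1b39488a0c`; `l. NNNN` = its lines).

## What this file is

In the proof of Thm. 4.18 (l. 2247–2268) Liu writes (l. 2250): «by pulling back `α`, we obtain a map `Ω(μ) → H¹_{B,τ'}(A_∞, ℂ)`,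
which is `ℂ[𝔾(𝔸_F^∞)]`-linear.  It canonically extends to a map» (4.3) `Ω(μ) ⊗_{M_μ} ℂ → H¹_{B,τ'}(A_∞, ℂ)` (l. 2251–2253).
The capstones of `Thm418CombinedOfRationalPullback.lean` (this lineage, p306697/p307787/p308024) derive the stage-1 package's
combined reading r8 at one `μ` from [Liu2021] Thm. 4.18 EXACTLY AS PRINTED with (4.3) presented HONESTLY through rational Betti
`H¹` — but they still carry the map itself as a pair of binders `(J, hJ43)`: «some `ℂ`-linear `J` on `ℂ ⊗_{M_μ} Ω(μ)` whose value on
pure tensors is `z ⊗ f ↦ ι (z · (f^*)_ℂ α)`».  THIS FILE proves the sentence «it canonically extends»: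

* `Thm418Data.exists_map43_of_rationalPullback` — such a `J` EXISTS, from exactly the two laws that make `f ↦ f^*α` an
  `M_μ`-linear map: «`M_μ` acts on `Ω(μ)` via `i_μ`» + contravariance of `H¹` (`hPM : (i_μ(m) ∘ f)^* = f^* ∘ i_μ(m)^*`, Def. 4.16
  l. 2219) and «`α` lies in the subspace over which `M_μ` acts via the inclusion `M_μ ↪ ℂ`» (`hα`, l. 2250).  Construction =
  Mathlib's `LinearMap.liftBaseChange` (the universal property of `ℂ ⊗_{M_μ} −`), as in item6-p1's bare-`ℂ` record
  `Thm418Data.Map43Data.J` (`Thm418ProofMapAsPrinted.lean`), here RECORD-FREE over the rational carriers;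
* `Thm418Data.map43_eq_of_formula` — and it is UNIQUE («canonically»): two `ℂ`-linear maps with that value on pure tensors agree;
* §2: hence the r8 shape at one `μ` for Liu's own CM classes `(φ^*α)|_K` — `iSup_range_resW_mem_span_liuClasses_of_thm418AsPrinted`
  of `Thm418CombinedOfRationalPullback.lean` — holds with NO `J`/`hJ43` binder (`…_of_carriers`), likewise for any consumer class set
  containing Liu's classes (`…_of_carriers_of_liuClasses_subset`) and in the bundled-intertwining-map currency of multiplicity one
  (`…_of_carriers_of_rank_intertwiningMap_le_one`).

After this file the binders of the X1 term («placement of the printed isomorphism inside `H¹_{B,τ'}(A_∞, ℂ)` through (4.3) +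
multiplicity one», pub-hodgecm2 HM-EQUALITY Δ2) are: `h : Thm418AsPrinted D` (Thm. 4.18 AS PRINTED); `Dμ` (Prop. 4.6 (1)); the
consumer's level family `Kof` and geometric side `resW`; the STRUCTURAL rational carriers — `L = H¹_B(A_μ; ℚ)` an `M_μ`-line (l. 650 +
Def. 4.5 (2)), `U = H¹_B(A_∞; ℚ)` with its Hecke action `ρU` (§4.2 l. 2074), the pull-back `P = (f ↦ f^*)` with its laws `hPM`/`hPact`
and faithfulness `hP`, the comparison `ι` (injective, equivariant) into the consumer's `ℂ[𝔾(𝔸_F^∞)]`-module `H`; Liu's `α` (l. 2250;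
any non-zero vector of the eigenline — existence: tree `Literature.LinearAlgebra.BaseChange.NumberFieldLineEigenline`, item6-p1);
`hnv` (Def. 4.11 / Lem. D.1 (1)); `hmult` (proof of Prop. 4.13, l. 2145).  NOTHING of the map (4.3) is assumed any more — neither the
map, nor its `ℂ[G]`-linearity (l. 2250), nor its injectivity (l. 2252–2266), nor the class identification.  Theorems only; no
definition, no named fact; nothing about Liu's objects is constructed as data (the map is obtained inside proofs).  HC_CM is NOT
proved; no pin of the COR-CM chain is discharged here (the consumer instantiates the carriers with the honest tower).
Seat prover-pub-hodgecm2-tr-prover-6-g5-0 (item-(vi) END-display lineage, X1 owner with item6-p1), 2026-08-21.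

## References
* [Liu2021] proof of Thm. 4.18, l. 2247–2268 (esp. l. 2250 and (4.3) = l. 2251–2253); Thm. 4.18 (l. 2232–2245); Prop. 4.13 with
  proof l. 2145; Lem. 2.4 (1) (l. 1210–1213); Def. 4.5 (2); Def. 4.11; Def. 4.16 (l. 2219); §4.2 l. 2074; l. 650.
* Tree: `Liu2021.Thm418CombinedOfRationalPullback` (§1–§3), `Liu2021.Map43Injective`, `Liu2021.Thm418BlockLeRange`,
  `Liu2021.Thm418CombinedReading` (pin-3), `Liu2021.Thm418AsPrinted` (p277833); Mathlib `LinearMap.liftBaseChange`.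
-/

noncomputable section

open scoped TensorProduct
open TensorProduct Module NumberField

namespace Literature.NumberTheory.Automorphic.Liu2021

namespace Thm418Data

variable {F E : Type} [Field F] [NumberField F] [IsTotallyReal F] [Field E] [NumberField E] [Algebra F E]
  [IsTotallyComplex E] [Algebra.IsQuadraticExtension F E] {D : Thm418Data F E}

/-! ## §1 — «It canonically extends to a map (4.3)» (l. 2250–2253): existence and uniqueness -/

/-- **[Liu2021, proof of Thm. 4.18, l. 2250] «It canonically extends to a map (4.3) `Ω(μ) ⊗_{M_μ} ℂ → H¹_{B,τ'}(A_∞, ℂ)`» — EXISTENCE,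
over rational carriers.**  Given the rational pull-back `P = (f ↦ f^*) : Ω(μ) → Hom_ℚ(L, U)` with the law `hPM`
(`(i_μ(m) ∘ f)^* = f^* ∘ i_μ(m)^*`: «`M_μ` acts via `i_μ`», Def. 4.16 l. 2219, + contravariance of `H¹`), Liu's `α ∈ ℂ ⊗_ℚ L` in the
eigenline (`hα`: «over which `M_μ` acts via the inclusion `M_μ ↪ ℂ`», l. 2250) and ANY `ℂ`-linear `ι : ℂ ⊗_ℚ U → H` (the comparison into
the consumer's `H = H¹_{B,τ'}(A_∞, ℂ)`), there is a `ℂ`-linear `J : ℂ ⊗_{M_μ} Ω(μ) → H` with `J (z ⊗ f) = ι (z · (f^*)_ℂ α)`.  Proof: the map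
`f ↦ ι ((f^*)_ℂ α)` is `M_μ`-linear — `(m·f)^*_ℂ α = (f^*)_ℂ ((i_μ(m)^*)_ℂ α) = (f^*)_ℂ (m · α) = m · (f^*)_ℂ α` — and `J` is its canonical
extension `LinearMap.liftBaseChange ℂ` (universal property of the base change).  No hypothesis on `ι`, none on `α` beyond `hα`.
HC_CM is NOT proved. [cite: Liu2021, proof of Thm. 4.18 (FJcycle.tex l. 2250–2253, map (4.3)); Def. 4.16 (l. 2219)] -/
theorem exists_map43_of_rationalPullback
    {L : Type*} [AddCommGroup L] [Module ℚ L] [Module (fieldOfValues E D.μ) L] [IsScalarTower ℚ (fieldOfValues E D.μ) L]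
    {U : Type*} [AddCommGroup U] [Module ℚ U]
    (P : D.Ω →+ (L →ₗ[ℚ] U))
    (hPM : ∀ (m : fieldOfValues E D.μ) (f : D.Ω) (l : L), P (m • f) l = P f (m • l))
    (α : ℂ ⊗[ℚ] L)
    (hα : ∀ m : fieldOfValues E D.μ,
      (DistribSMul.toLinearMap ℚ L m).baseChange ℂ α = algebraMap (fieldOfValues E D.μ) ℂ m • α)
    {H : Type*} [AddCommGroup H] [Module ℂ H] (ι : ℂ ⊗[ℚ] U →ₗ[ℂ] H) :
    ∃ J : ℂ ⊗[fieldOfValues E D.μ] D.Ω →ₗ[ℂ] H,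
      ∀ (z : ℂ) (f : D.Ω), J (z ⊗ₜ[fieldOfValues E D.μ] f) = ι (z • (P f).baseChange ℂ α) := by
  have hPM' : ∀ (m : fieldOfValues E D.μ) (f : D.Ω), P (m • f) = P f ∘ₗ DistribSMul.toLinearMap ℚ L m :=
    fun m f => LinearMap.ext (hPM m f)
  -- «by pulling back `α`, we obtain a map `Ω(μ) → H¹_{B,τ'}(A_∞, ℂ)`» (l. 2250), `M_μ`-linear:
  let pb : D.Ω →ₗ[fieldOfValues E D.μ] H :=
    { toFun := fun f => ι ((P f).baseChange ℂ α)
      map_add' := fun f f' => by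
        simp only [map_add, LinearMap.baseChange_add, LinearMap.add_apply]
      map_smul' := fun m f => by
        simp only [RingHom.id_apply, hPM', LinearMap.baseChange_comp, LinearMap.comp_apply, hα, map_smul,
          IntermediateField.smul_def, IntermediateField.algebraMap_apply] }
  -- «It canonically extends to a map (4.3)» (l. 2250–2253):
  refine ⟨pb.liftBaseChange ℂ, fun z f => ?_⟩
  rw [LinearMap.liftBaseChange_tmul, map_smul]
  rfl

/-- **«canonically» (l. 2250): the map (4.3) is UNIQUE** — two `ℂ`-linear maps on `ℂ ⊗_{M_μ} Ω(μ)` with the value `z ⊗ f ↦ ι (z · (f^*)_ℂ α)`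
on pure tensors coincide (pure tensors span).  So every statement of this lineage quantifying over «a `J` with `hJ43`» is a statement
about THE map (4.3).  HC_CM is NOT proved. [cite: Liu2021, proof of Thm. 4.18 (FJcycle.tex l. 2250–2253, map (4.3))] -/
theorem map43_eq_of_formula
    {L : Type*} [AddCommGroup L] [Module ℚ L]
    {U : Type*} [AddCommGroup U] [Module ℚ U]
    (P : D.Ω →+ (L →ₗ[ℚ] U)) (α : ℂ ⊗[ℚ] L)
    {H : Type*} [AddCommGroup H] [Module ℂ H] (ι : ℂ ⊗[ℚ] U →ₗ[ℂ] H)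
    (J J' : ℂ ⊗[fieldOfValues E D.μ] D.Ω →ₗ[ℂ] H)
    (hJ43 : ∀ (z : ℂ) (f : D.Ω), J (z ⊗ₜ[fieldOfValues E D.μ] f) = ι (z • (P f).baseChange ℂ α))
    (hJ'43 : ∀ (z : ℂ) (f : D.Ω), J' (z ⊗ₜ[fieldOfValues E D.μ] f) = ι (z • (P f).baseChange ℂ α)) :
    J = J' := by
  refine LinearMap.ext fun x => ?_
  induction x using TensorProduct.induction_on with
  | zero => simp
  | tmul z f => rw [hJ43, hJ'43]
  | add x y hx hy => simp only [map_add, hx, hy]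

/-! ## §2 — the r8 shape at one `μ` with NO binder about the map (4.3) -/

/-- **r8 at one `μ` for LIU'S OWN CM classes `(φ^*α)|_K`, over the STRUCTURAL carriers only — NO `Φ`, `hblock`, `J`, `hJ43`, `hJ`, `hJinj`,
`hpin` binder.**  From [Liu2021] Thm. 4.18 AS PRINTED (`h`), an object `Dμ` (Prop. 4.6 (1)), the consumer's level family and geometric
side, the rational carriers {`L = H¹_B(A_μ; ℚ)` an `M_μ`-line (`hL`; l. 650 + Def. 4.5 (2)), `U = H¹_B(A_∞; ℚ)` with Hecke action `ρU`,
`P = (f ↦ f^*)` with `hPM` (Def. 4.16 l. 2219) / `hPact` (§4.2 l. 2074) / faithfulness `hP`, the comparison `ι` with `hι`/`hιact`},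
Liu's `α` (`hα0`, `hα`; l. 2250), `hnv` (Def. 4.11 / Lem. D.1 (1)) and `hmult` (proof of Prop. 4.13, l. 2145): below some level `K₀`,
every `Kof K`-fixed vector of the intrinsic `μ`-block `⨆_{(ε,χ)} ⨆_{ψ : ω(μ,ε,χ) →ₗ[ℂ[G]] H} range ψ` restricts, under `resW K`, into the
`ℂ`-span of Liu's classes `resW K (ι ((φ^*)_ℂ α))`, `φ ∈ Hom_E(A_K, A_μ)_ℚ` (`= (φ^*α)|_{X_K}`, Lem. 2.4 (1) l. 1210–1213).  The map (4.3)
is obtained INSIDE the proof (`exists_map43_of_rationalPullback`) and handed to §3 of `Thm418CombinedOfRationalPullback.lean`.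
HC_CM is NOT proved; no pin is discharged here.
[cite: Liu2021, Thm. 4.18 (l. 2232–2245) with proof and map (4.3) (l. 2247–2268); Prop. 4.13, proof l. 2145; Lem. 2.4 (1) (l. 1210–1213); Def. 4.11; Def. 4.16 (l. 2219)] -/
theorem iSup_range_resW_mem_span_liuClasses_of_thm418AsPrinted_of_carriers (h : Liu2021.Thm418AsPrinted D) (Dμ : D.Obj)
    {Lvl : Type*} [Preorder Lvl] (Kof : Lvl → Subgroup D.G)
    (hmono : ∀ ⦃K K' : Lvl⦄, K ≤ K' → Kof K ≤ Kof K') (hoc : ∀ K : Lvl, IsOpenCompact (Kof K))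
    (hcof : ∀ K' : Subgroup D.G, IsOpenCompact K' → ∃ K₀ : Lvl, Kof K₀ ≤ K')
    {H : Type*} [AddCommGroup H] [Module ℂ H] [Module (MonoidAlgebra ℂ D.G) H] [IsScalarTower ℂ (MonoidAlgebra ℂ D.G) H]
    {W : Lvl → Type*} [∀ K, AddCommGroup (W K)] [∀ K, Module ℂ (W K)]
    (resW : ∀ K : Lvl, H →ₗ[ℂ] W K)
    {L : Type*} [AddCommGroup L] [Module ℚ L] [Module (fieldOfValues E D.μ) L] [IsScalarTower ℚ (fieldOfValues E D.μ) L]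
    [Module.Finite ℚ L] (hL : Module.finrank (fieldOfValues E D.μ) L = 1)
    {U : Type*} [AddCommGroup U] [Module ℚ U]
    (P : D.Ω →+ (L →ₗ[ℚ] U))
    (hPM : ∀ (m : fieldOfValues E D.μ) (f : D.Ω) (l : L), P (m • f) l = P f (m • l))
    (hP : Function.Injective P)
    (ρU : D.G → (U →ₗ[ℚ] U)) (hPact : ∀ (g : D.G) (f : D.Ω), P (D.rhoΩ g f) = ρU g ∘ₗ P f)
    (α : ℂ ⊗[ℚ] L) (hα0 : α ≠ 0)
    (hα : ∀ m : fieldOfValues E D.μ,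
      (DistribSMul.toLinearMap ℚ L m).baseChange ℂ α = algebraMap (fieldOfValues E D.μ) ℂ m • α)
    (ι : ℂ ⊗[ℚ] U →ₗ[ℂ] H) (hι : Function.Injective ι)
    (hιact : ∀ (g : D.G) (u : ℂ ⊗[ℚ] U), ι ((ρU g).baseChange ℂ u) = MonoidAlgebra.of ℂ D.G g • ι u)
    (hnv : ∀ i : D.AdmIndex, Nontrivial (D.omegaAt i))
    (hmult : ∀ i : D.AdmIndex, Module.rank ℂ ((D.rhoAt i).asModule →ₗ[MonoidAlgebra ℂ D.G] H) ≤ 1) :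
    ∃ K₀ : Lvl, ∀ K ≤ K₀,
      ∀ x ∈ (⨆ i : D.AdmIndex, ⨆ ψ : (D.rhoAt i).asModule →ₗ[MonoidAlgebra ℂ D.G] H, (LinearMap.range ψ).restrictScalars ℂ),
        (∀ k ∈ Kof K, MonoidAlgebra.of ℂ D.G k • x = x) →
          resW K x ∈ Submodule.span ℂ
            (Set.range fun φ : D.HomK (Kof K) Dμ => resW K (ι ((P (D.res (Kof K) Dμ φ)).baseChange ℂ α))) := by
  obtain ⟨J, hJ43⟩ := exists_map43_of_rationalPullback P hPM α hα ι
  exact iSup_range_resW_mem_span_liuClasses_of_thm418AsPrinted h Dμ Kof hmono hoc hcof resW hL P hPM hP ρU hPact α hα0 hα ι hι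
    hιact J hJ43 hnv hmult

/-- **The same for any consumer class set `cmCl K` CONTAINING Liu's classes** (`hcm : resW K (ι ((φ^*)_ℂ α)) ∈ cmCl K` — stated on the
rational formula; e.g. the package's `cmClasses K μ ⊇` the classes of `d = (A_μ, α)`), by `Submodule.span_mono`; NO binder about (4.3).
HC_CM is NOT proved; no pin is discharged here.
[cite: Liu2021, Thm. 4.18 (l. 2232–2245) with proof and map (4.3) (l. 2247–2268); Prop. 4.13, proof l. 2145; Lem. 2.4 (1) (l. 1210–1213); Def. 4.11; Def. 4.16 (l. 2219)] -/
theorem iSup_range_resW_mem_span_of_thm418AsPrinted_of_carriers_of_liuClasses_subset (h : Liu2021.Thm418AsPrinted D)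
    (Dμ : D.Obj)
    {Lvl : Type*} [Preorder Lvl] (Kof : Lvl → Subgroup D.G)
    (hmono : ∀ ⦃K K' : Lvl⦄, K ≤ K' → Kof K ≤ Kof K') (hoc : ∀ K : Lvl, IsOpenCompact (Kof K))
    (hcof : ∀ K' : Subgroup D.G, IsOpenCompact K' → ∃ K₀ : Lvl, Kof K₀ ≤ K')
    {H : Type*} [AddCommGroup H] [Module ℂ H] [Module (MonoidAlgebra ℂ D.G) H] [IsScalarTower ℂ (MonoidAlgebra ℂ D.G) H]
    {W : Lvl → Type*} [∀ K, AddCommGroup (W K)] [∀ K, Module ℂ (W K)]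
    (resW : ∀ K : Lvl, H →ₗ[ℂ] W K) (cmCl : ∀ K : Lvl, Set (W K))
    {L : Type*} [AddCommGroup L] [Module ℚ L] [Module (fieldOfValues E D.μ) L] [IsScalarTower ℚ (fieldOfValues E D.μ) L]
    [Module.Finite ℚ L] (hL : Module.finrank (fieldOfValues E D.μ) L = 1)
    {U : Type*} [AddCommGroup U] [Module ℚ U]
    (P : D.Ω →+ (L →ₗ[ℚ] U))
    (hPM : ∀ (m : fieldOfValues E D.μ) (f : D.Ω) (l : L), P (m • f) l = P f (m • l))
    (hP : Function.Injective P)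
    (ρU : D.G → (U →ₗ[ℚ] U)) (hPact : ∀ (g : D.G) (f : D.Ω), P (D.rhoΩ g f) = ρU g ∘ₗ P f)
    (α : ℂ ⊗[ℚ] L) (hα0 : α ≠ 0)
    (hα : ∀ m : fieldOfValues E D.μ,
      (DistribSMul.toLinearMap ℚ L m).baseChange ℂ α = algebraMap (fieldOfValues E D.μ) ℂ m • α)
    (ι : ℂ ⊗[ℚ] U →ₗ[ℂ] H) (hι : Function.Injective ι)
    (hιact : ∀ (g : D.G) (u : ℂ ⊗[ℚ] U), ι ((ρU g).baseChange ℂ u) = MonoidAlgebra.of ℂ D.G g • ι u)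
    (hcm : ∀ (K : Lvl) (φ : D.HomK (Kof K) Dμ), resW K (ι ((P (D.res (Kof K) Dμ φ)).baseChange ℂ α)) ∈ cmCl K)
    (hnv : ∀ i : D.AdmIndex, Nontrivial (D.omegaAt i))
    (hmult : ∀ i : D.AdmIndex, Module.rank ℂ ((D.rhoAt i).asModule →ₗ[MonoidAlgebra ℂ D.G] H) ≤ 1) :
    ∃ K₀ : Lvl, ∀ K ≤ K₀,
      ∀ x ∈ (⨆ i : D.AdmIndex, ⨆ ψ : (D.rhoAt i).asModule →ₗ[MonoidAlgebra ℂ D.G] H, (LinearMap.range ψ).restrictScalars ℂ),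
        (∀ k ∈ Kof K, MonoidAlgebra.of ℂ D.G k • x = x) → resW K x ∈ Submodule.span ℂ (cmCl K) := by
  obtain ⟨J, hJ43⟩ := exists_map43_of_rationalPullback P hPM α hα ι
  exact iSup_range_resW_mem_span_of_thm418AsPrinted_of_liuClasses_subset h Dμ Kof hmono hoc hcof resW cmCl hL P hPM hP ρU hPact α
    hα0 hα ι hι hιact J hJ43 hcm hnv hmult

/-- **The same for Liu's own classes with multiplicity one in the RECORD'S currency** (bundled intertwining maps
`Representation.IntertwiningMap (ρ(μ,ε,χ)) (ofModule' H)` — LITERALLY `Prop413Data.MultOneAsPrinted.rank_intertwiningMap_le_one` at the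
consumer's pin); NO binder about (4.3).  Via `iSup_range_resW_mem_span_of_thm418AsPrinted_of_rationalPullback_of_rank_intertwiningMap_le_one`
at `cmCl K :=` Liu's classes, where `hpin` holds by `J (1 ⊗ res_K φ) = ι ((φ^*)_ℂ α)` (the formula at `z = 1`).
HC_CM is NOT proved; no pin is discharged here.
[cite: Liu2021, Thm. 4.18 (l. 2232–2245) with proof and map (4.3) (l. 2247–2268); Prop. 4.13, proof l. 2145; Lem. 2.4 (1) (l. 1210–1213); Def. 4.11; Def. 4.16 (l. 2219)] -/
theorem iSup_range_resW_mem_span_liuClasses_of_thm418AsPrinted_of_carriers_of_rank_intertwiningMap_le_one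
    (h : Liu2021.Thm418AsPrinted D) (Dμ : D.Obj)
    {Lvl : Type*} [Preorder Lvl] (Kof : Lvl → Subgroup D.G)
    (hmono : ∀ ⦃K K' : Lvl⦄, K ≤ K' → Kof K ≤ Kof K') (hoc : ∀ K : Lvl, IsOpenCompact (Kof K))
    (hcof : ∀ K' : Subgroup D.G, IsOpenCompact K' → ∃ K₀ : Lvl, Kof K₀ ≤ K')
    {H : Type*} [AddCommGroup H] [Module ℂ H] [Module (MonoidAlgebra ℂ D.G) H] [IsScalarTower ℂ (MonoidAlgebra ℂ D.G) H]
    {W : Lvl → Type*} [∀ K, AddCommGroup (W K)] [∀ K, Module ℂ (W K)]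
    (resW : ∀ K : Lvl, H →ₗ[ℂ] W K)
    {L : Type*} [AddCommGroup L] [Module ℚ L] [Module (fieldOfValues E D.μ) L] [IsScalarTower ℚ (fieldOfValues E D.μ) L]
    [Module.Finite ℚ L] (hL : Module.finrank (fieldOfValues E D.μ) L = 1)
    {U : Type*} [AddCommGroup U] [Module ℚ U]
    (P : D.Ω →+ (L →ₗ[ℚ] U))
    (hPM : ∀ (m : fieldOfValues E D.μ) (f : D.Ω) (l : L), P (m • f) l = P f (m • l))
    (hP : Function.Injective P)
    (ρU : D.G → (U →ₗ[ℚ] U)) (hPact : ∀ (g : D.G) (f : D.Ω), P (D.rhoΩ g f) = ρU g ∘ₗ P f)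
    (α : ℂ ⊗[ℚ] L) (hα0 : α ≠ 0)
    (hα : ∀ m : fieldOfValues E D.μ,
      (DistribSMul.toLinearMap ℚ L m).baseChange ℂ α = algebraMap (fieldOfValues E D.μ) ℂ m • α)
    (ι : ℂ ⊗[ℚ] U →ₗ[ℂ] H) (hι : Function.Injective ι)
    (hιact : ∀ (g : D.G) (u : ℂ ⊗[ℚ] U), ι ((ρU g).baseChange ℂ u) = MonoidAlgebra.of ℂ D.G g • ι u)
    (hnv : ∀ i : D.AdmIndex, Nontrivial (D.omegaAt i))
    (hmult : ∀ i : D.AdmIndex,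
      Module.rank ℂ (Representation.IntertwiningMap (D.rhoAt i) (Representation.ofModule' (k := ℂ) H)) ≤ 1) :
    ∃ K₀ : Lvl, ∀ K ≤ K₀,
      ∀ x ∈ (⨆ i : D.AdmIndex, ⨆ ψ : (D.rhoAt i).asModule →ₗ[MonoidAlgebra ℂ D.G] H, (LinearMap.range ψ).restrictScalars ℂ),
        (∀ k ∈ Kof K, MonoidAlgebra.of ℂ D.G k • x = x) →
          resW K x ∈ Submodule.span ℂ
            (Set.range fun φ : D.HomK (Kof K) Dμ => resW K (ι ((P (D.res (Kof K) Dμ φ)).baseChange ℂ α))) := by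
  obtain ⟨J, hJ43⟩ := exists_map43_of_rationalPullback P hPM α hα ι
  exact iSup_range_resW_mem_span_of_thm418AsPrinted_of_rationalPullback_of_rank_intertwiningMap_le_one h Dμ Kof hmono hoc hcof
    resW (fun K => Set.range fun φ : D.HomK (Kof K) Dμ => resW K (ι ((P (D.res (Kof K) Dμ φ)).baseChange ℂ α)))
    hL P hPM hP ρU hPact α hα0 hα ι hι hιact J hJ43 (fun K φ => ⟨φ, by rw [hJ43, one_smul]⟩) hnv hmult

end Thm418Data

end Literature.NumberTheory.Automorphic.Liu2021

end
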